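/-
Copyright (c) 2026 the pub-hodgecm-mathlib formalisation cell (harness21).  Prover seat hodgecm-mathlib-K2E4-p11 (g10) on the S4 valve (dealer K2E2-plan (g8), S4-R47,
CARD E «TJ-LOC», file (TL-a)): THE CAYLEY TUBE ESTIMATES AT A NON-INTEGRAL BASE POINT — ★ C5 `Literature.NumberTheory.Weil1982.CayleyTwistedSandwich` §3–§4 and ★ (TJ2) part 1
`R90S4CayleyTwistedThirdSlot` with the integrality binders `ValBound 1 T`, `ValBound 1 T⁻¹` replaced by bounds on the conjugates (loss factor `λ = γ′·γ`).
Crux H413 `stmt-HodgeConjecture-24833`, lane `--supports … --as helper` (count-neutral).  THEOREMS ONLY (no `def`, no `instance`, no notation, no named-fact hypothesis, no `sorry`).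
-/
import Summits.HodgeConjecture.HodgeConjecture.Theorems.R90S4CayleyTwistedThirdSlot   -- ★ (TJ2) part 1 p864574: the integral third-slot lemmas; brings ★ C5 `CayleyTwistedSandwich`, ★ C2 `CayleyProductSandwich`, ★ `ValBound`
import HarnessLib

/-!
# R90-TF · S4 (Ch. 13.1–2) · road (J̃♭) «TWISTED TUBE JACOBIAN», CARD E «TJ-LOC» file (TL-a): THE CAYLEY TUBE WITH A LOSS FACTOR — the tube identity, box stability
# and the filtered Newton increment of ★ C5 ∕ ★ (TJ2) part 1 AT A NON-INTEGRAL BASE POINT `T = ρ(b₀)` (hyperbolic member `T = M` of the (J̃♭) letter)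

Dealt by the S4 dealer K2E2-plan (g8) (S4-R47, 2026-09-05T02:40:41Z, on the census `K2/K2E4-p11/g10/CENSUS-TJ-LOC.md` 5dd07fbad23f3055).  Seat K2E4-p11 (g10).
THE POINT.  On the compact Cartan road (★ C8, and its ε-twin ★ (TJ2) `R90S4TwistedTubeCore` p864605) the base point `t₀ = T` of the tube `c(X)·T·c(Y)·c(X′)` is INTEGRAL:
`ValBound 1 T`, `ValBound 1 T⁻¹` — used in exactly one way, through ★ C5 `valBound_conj` (`X ≤ ρ ⇒ T⁻¹XT ≤ ρ`).  At the HYPERBOLIC member `T = M` of the twisted Weyl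
integration formula [Rogawski1990, §12.5 p. 186] the base point `b₀ ∈ T̃` with `N b₀ ∈ M^{reg}` is unbounded modulo `Z̃·(1−ε)T̃` (census §(ii): the quotient of valuation
vectors is `ℤ`, generated by the hyperbolic direction `ord α(N b₀)`), so `T = ρ(b₀)` is NOT integral.  Nothing else changes: with `T ≤ γ`, `T⁻¹ ≤ γ′` entrywise the conjugate obeys
`T⁻¹XT ≤ γ′·ρ·γ` (§1, the LOSS FACTOR `λ = γ′γ`), and every ★ estimate goes through VERBATIM once the bound on the conjugate is taken as the hypothesis — which is how this
file states them (§2 for ★ C5's third slot `−X`, §3 for ★ (TJ2) part 1's additive third slot `E`): the consumer ((TL-b′) `R90S4TwistedTubeCoreLoss`, the loss twin of ★ p864605)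
starts the filtered Newton scheme `a = ord λ` levels deeper, so that `T⁻¹XT` lands in the box again, and feeds ★ C8a `F0P3cStCharTSTubeMeasureChart.tube_measure_eq` — whose linear
part is an ARBITRARY `L : V ≃ₜ+ V` and whose Newton hypothesis is already two-lattice (`∈ L '' Λ (j+1)`) — unchanged.  §4: the ★ integral statements are the case `γ = γ′ = 1`
(sanity `example`s, not exports).

## CONTENTS
* §1 `valBound_conj_of_valBound` (`T ≤ γ`, `T⁻¹ ≤ γ′`, `X ≤ ρ` ⇒ `T⁻¹XT ≤ γ′ργ`), `valBound_conj_of_valBound_of_le`.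
* §2 (third slot `−X`, ★ C5 twins): `cayley_twisted_triple_of_valBound`, `valBound_twistedSandwich_of_valBound`, `valBound_twisted_incr_of_sandwich_of_valBound`,
  `valBound_twistedSandwich_incr_of_valBound`.
* §3 (additive third slot `E`, ★ (TJ2) part 1 twins): `cayley_twisted_triple_slot_of_valBound`, `valBound_twistedSandwich_slot_of_valBound`,
  `valBound_twisted_incr_of_sandwich_slot_of_valBound`, `valBound_twistedSandwich_incr_slot_of_valBound` (★ `twistedSandwich_slot_zero` is already base-point-free).
* §4 sanity: the ★ integral forms at `γ = γ′ = 1`.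

HONEST LABEL: HC_CM is proved only modulo the 7 printed citations (2 remaining named inputs: hLiu418 = `stmt-HodgeConjecture-24832`, h413 = `stmt-HodgeConjecture-24833`)
until rung 0 closes; this file closes no organ ((J̃♭) stays OPEN, both rows); count-neutral helper.

## References
* [Serre1992LALG] J.-P. Serre, *Lie Algebras and Lie Groups*, LNM 1500 (1992), Part II Ch. IV §8–§9 (standard groups: group law and conjugation are `linear + O(2)`).
* [PlatonovRapinchuk1994] V. Platonov, A. Rapinchuk, *Algebraic Groups and Number Theory* (1994), §3.3 (congruence subgroups via the Cayley map).
* [HarishChandra1970] Harish-Chandra (notes by G. van Dijk), *Harmonic Analysis on Reductive p-adic Groups*, LNM 162 (1970), Lemma 22.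
* [Rogawski1990] J. Rogawski, *Automorphic Representations of Unitary Groups in Three Variables*, Ann. of Math. Stud. 123 (1990), §12.5 pp. 182, 186.
-/

set_option autoImplicit false
set_option linter.dupNamespace false

open Matrix ValuativeRel Literature.NumberTheory.Automorphic
open Literature.NumberTheory.Weil1982.UnitaryFinTopForm
open scoped Matrix

namespace Summit.HodgeConjecture.HodgeConjecture.R90.S4

variable {F : Type*} [Field F] [ValuativeRel F] {m : Type*} [Fintype m] [DecidableEq m]

/-! ## §1 Conjugation by a non-integral base point: the loss factor -/

omit [DecidableEq m] in
/-- **CONJUGATION WITH A LOSS FACTOR**: `T ≤ γ`, `T⁻¹ ≤ γ′`, `X ≤ ρ` entrywise ⇒ `T⁻¹ X T ≤ γ′·ρ·γ` (★ C5 `valBound_conj` is `γ = γ′ = 1`).  At a hyperbolic base point of the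
twisted Weyl integration formula `γ′γ > 1` is the price of non-integrality, paid by starting the Newton scheme deeper. [cite: PlatonovRapinchuk1994, §3.3] [cite: Rogawski1990, §12.5 p. 186] -/
theorem valBound_conj_of_valBound {ρ γ γ' : ValueGroupWithZero F} {T Tinv X : Matrix m m F} (hT : ValBound γ T) (hTinv : ValBound γ' Tinv)
    (hX : ValBound ρ X) : ValBound (γ' * ρ * γ) (Tinv * X * T) :=
  (hTinv.mul hX).mul hT

omit [DecidableEq m] in
/-- The loss factor absorbed in a target radius: `γ′·ρ·γ ≤ ρ₁ ⇒ T⁻¹ X T ≤ ρ₁`. [cite: PlatonovRapinchuk1994, §3.3] -/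
theorem valBound_conj_of_valBound_of_le {ρ ρ₁ γ γ' : ValueGroupWithZero F} {T Tinv X : Matrix m m F} (hT : ValBound γ T) (hTinv : ValBound γ' Tinv)
    (hX : ValBound ρ X) (hle : γ' * ρ * γ ≤ ρ₁) : ValBound ρ₁ (Tinv * X * T) :=
  (valBound_conj_of_valBound hT hTinv hX).mono hle

/-! ## §2 Third slot `−X` (★ C5) at a non-integral base point -/

/-- **THE TUBE IN THE CHART AT A NON-INTEGRAL BASE POINT**: `T⁻¹·c(X)·T·c(Y)·c(−X) = c(Θ)`, `Θ = S(T⁻¹XT, S(Y, −X))`, for `X, Y ≤ ρ < 1` and the CONJUGATE `T⁻¹XT ≤ ρ`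
(in place of ★ C5 `cayley_twisted_triple`'s `T, T⁻¹` integral). [cite: Serre1992LALG, Part II Ch. IV §8] [cite: PlatonovRapinchuk1994, §3.3] -/
theorem cayley_twisted_triple_of_valBound {ρ : ValueGroupWithZero F} {T Tinv X Y : Matrix m m F} (hT : T * Tinv = 1) (hT' : Tinv * T = 1)
    (hX : ValBound ρ X) (hXc : ValBound ρ (Tinv * X * T)) (hY : ValBound ρ Y) (hρ : ρ < 1) :
    Tinv * cayley X * T * cayley Y * cayley (-X)
      = cayley ((1 - Tinv * X * T)⁻¹ * (Tinv * X * T + ((1 - Y)⁻¹ * (Y + -X) * (1 + Y * -X)⁻¹ * (1 - Y)))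
          * (1 + (Tinv * X * T) * ((1 - Y)⁻¹ * (Y + -X) * (1 + Y * -X)⁻¹ * (1 - Y)))⁻¹ * (1 - Tinv * X * T)) := by
  have hnX : ValBound ρ (-X) := hX.neg
  obtain ⟨hXu, -, -⟩ := isUnit_det_one_sub_of_valBound hX hρ
  obtain ⟨hX'u, -, -⟩ := isUnit_det_one_sub_of_valBound hXc hρ
  obtain ⟨hYu, -, -⟩ := isUnit_det_one_sub_of_valBound hY hρ
  obtain ⟨hnXu, -, -⟩ := isUnit_det_one_sub_of_valBound hnX hρ
  obtain ⟨hBu, -, -⟩ := isUnit_det_one_add_mul_of_valBound hY hnX hρ hρ.le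
  have hZ : ValBound ρ ((1 - Y)⁻¹ * (Y + -X) * (1 + Y * -X)⁻¹ * (1 - Y)) := by
    simpa using valBound_cayleySandwich hY hnX hρ hρ
  obtain ⟨hZu, -, -⟩ := isUnit_det_one_sub_of_valBound hZ hρ
  obtain ⟨hB'u, -, -⟩ := isUnit_det_one_add_mul_of_valBound hXc hZ hρ hρ.le
  rw [conj_cayley hT hT' hXu, Matrix.mul_assoc, cayley_mul_cayley_eq_cayley hYu hnXu hBu,
    cayley_mul_cayley_eq_cayley hX'u hZu hB'u]

/-- The tube map stays in the box at a non-integral base point: `Θ(X, Y) ≤ ρ` from `T⁻¹XT, X, Y ≤ ρ < 1`. [cite: Serre1992LALG, Part II Ch. IV §8] -/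
theorem valBound_twistedSandwich_of_valBound {ρ : ValueGroupWithZero F} {T Tinv X Y : Matrix m m F}
    (hX : ValBound ρ X) (hXc : ValBound ρ (Tinv * X * T)) (hY : ValBound ρ Y) (hρ : ρ < 1) :
    ValBound ρ ((1 - Tinv * X * T)⁻¹ * (Tinv * X * T + ((1 - Y)⁻¹ * (Y + -X) * (1 + Y * -X)⁻¹ * (1 - Y)))
          * (1 + (Tinv * X * T) * ((1 - Y)⁻¹ * (Y + -X) * (1 + Y * -X)⁻¹ * (1 - Y)))⁻¹ * (1 - Tinv * X * T)) := by
  have hZ : ValBound ρ ((1 - Y)⁻¹ * (Y + -X) * (1 + Y * -X)⁻¹ * (1 - Y)) := by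
    simpa using valBound_cayleySandwich hY hX.neg hρ hρ
  simpa using valBound_cayleySandwich hXc hZ hρ hρ

omit [DecidableEq m] in
/-- **THE FILTERED NEWTON ESTIMATE FOR A TWISTED COMPOSITE AT A NON-INTEGRAL BASE POINT, abstract form**: for ANY box-stable binary operation `S` whose joint increments
gain the factor `ρ`, the tube map `Θ(X, Y) := S(T⁻¹XT, S(Y, −X))` satisfies `Θ(X + X₁, Y + Y₁) − Θ(X, Y) − (T⁻¹X₁T − X₁ + Y₁) ≤ ργ` as soon as the CONJUGATES obey
`T⁻¹XT ≤ ρ`, `T⁻¹X₁T ≤ γ` (★ C5 `valBound_twisted_incr_of_sandwich` derives these from integrality of `T`; here they are the hypotheses) and `X, Y ≤ ρ < 1`, `X₁, Y₁ ≤ γ ≤ ρ`.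
[cite: Serre1992LALG, Part II Ch. IV §8] -/
theorem valBound_twisted_incr_of_sandwich_of_valBound (S : Matrix m m F → Matrix m m F → Matrix m m F) {ρ γ : ValueGroupWithZero F} (hρ : ρ < 1) (hγ : γ ≤ ρ)
    (hbox : ∀ {W X : Matrix m m F}, ValBound ρ W → ValBound ρ X → ValBound ρ (S W X))
    (hincr : ∀ {δ ε : ValueGroupWithZero F} {W X D E : Matrix m m F}, ValBound ρ W → ValBound ρ X → ValBound δ D → ValBound ε E →
      δ ≤ ρ → ε ≤ ρ → ValBound (ρ * max δ ε) (S (W + D) (X + E) - S W X - D - E))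
    {T Tinv X Y X₁ Y₁ : Matrix m m F} (hW : ValBound ρ (Tinv * X * T)) (hD : ValBound γ (Tinv * X₁ * T))
    (hX : ValBound ρ X) (hY : ValBound ρ Y) (hX₁ : ValBound γ X₁) (hY₁ : ValBound γ Y₁) :
    ValBound (ρ * γ) (S (Tinv * (X + X₁) * T) (S (Y + Y₁) (-(X + X₁))) - S (Tinv * X * T) (S Y (-X)) - (Tinv * X₁ * T - X₁ + Y₁)) := by
  have hnX : ValBound ρ (-X) := hX.neg
  have hnX₁ : ValBound γ (-X₁) := hX₁.neg
  -- inner increment: `E := S (Y + Y₁) (−X − X₁) − S Y (−X)` is `Y₁ − X₁` up to `ργ`, hence `≤ γ`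
  have hinner : ValBound (ρ * γ) (S (Y + Y₁) (-X + -X₁) - S Y (-X) - Y₁ - -X₁) := by
    simpa only [max_self] using hincr hY hnX hY₁ hnX₁ hγ hγ
  have hZ : ValBound ρ (S Y (-X)) := hbox hY hnX
  have hE : ValBound γ (S (Y + Y₁) (-X + -X₁) - S Y (-X)) := by
    have e : S (Y + Y₁) (-X + -X₁) - S Y (-X) = (S (Y + Y₁) (-X + -X₁) - S Y (-X) - Y₁ - -X₁) + (Y₁ + -X₁) := by abel
    rw [e]
    refine (hinner.mono ?_).add (hY₁.add hnX₁)
    calc ρ * γ ≤ 1 * γ := mul_le_mul' hρ.le le_rfl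
      _ = γ := one_mul γ
  -- outer increment
  have houter : ValBound (ρ * γ) (S (Tinv * X * T + Tinv * X₁ * T) (S Y (-X) + (S (Y + Y₁) (-X + -X₁) - S Y (-X)))
      - S (Tinv * X * T) (S Y (-X)) - Tinv * X₁ * T - (S (Y + Y₁) (-X + -X₁) - S Y (-X))) := by
    simpa only [max_self] using hincr hW hZ hD hE hγ hγ
  -- assemble
  have eW : Tinv * (X + X₁) * T = Tinv * X * T + Tinv * X₁ * T := by rw [Matrix.mul_add, Matrix.add_mul]
  have eZ : S Y (-X) + (S (Y + Y₁) (-X + -X₁) - S Y (-X)) = S (Y + Y₁) (-X + -X₁) := by abel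
  have eN : -(X + X₁) = -X + -X₁ := neg_add X X₁
  rw [eW, eN, ← eZ]
  have e : S (Tinv * X * T + Tinv * X₁ * T) (S Y (-X) + (S (Y + Y₁) (-X + -X₁) - S Y (-X))) - S (Tinv * X * T) (S Y (-X))
        - (Tinv * X₁ * T - X₁ + Y₁)
      = (S (Tinv * X * T + Tinv * X₁ * T) (S Y (-X) + (S (Y + Y₁) (-X + -X₁) - S Y (-X)))
          - S (Tinv * X * T) (S Y (-X)) - Tinv * X₁ * T - (S (Y + Y₁) (-X + -X₁) - S Y (-X)))
        + (S (Y + Y₁) (-X + -X₁) - S Y (-X) - Y₁ - -X₁) := by abel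
  rw [e]
  exact houter.add hinner

/-- **THE FILTERED NEWTON ESTIMATE FOR THE TUBE MAP AT A NON-INTEGRAL BASE POINT** (Cayley-sandwich instance of the abstract form): with
`Θ(X, Y) = S(T⁻¹XT, S(Y, −X))`, `S(W, X) = (1 − W)⁻¹(W + X)(1 + WX)⁻¹(1 − W)`, `L(X₁, Y₁) = T⁻¹X₁T − X₁ + Y₁`:
`Θ(X + X₁, Y + Y₁) − Θ(X, Y) − L(X₁, Y₁) ≤ ργ` for `T⁻¹XT, X, Y ≤ ρ < 1`, `T⁻¹X₁T, X₁, Y₁ ≤ γ ≤ ρ`. [cite: Serre1992LALG, Part II Ch. IV §8] -/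
theorem valBound_twistedSandwich_incr_of_valBound {ρ γ : ValueGroupWithZero F} (hρ : ρ < 1) (hγ : γ ≤ ρ) {T Tinv X Y X₁ Y₁ : Matrix m m F}
    (hW : ValBound ρ (Tinv * X * T)) (hD : ValBound γ (Tinv * X₁ * T))
    (hX : ValBound ρ X) (hY : ValBound ρ Y) (hX₁ : ValBound γ X₁) (hY₁ : ValBound γ Y₁) :
    ValBound (ρ * γ)
      ((fun W Z : Matrix m m F => (1 - W)⁻¹ * (W + Z) * (1 + W * Z)⁻¹ * (1 - W)) (Tinv * (X + X₁) * T)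
          ((fun W Z : Matrix m m F => (1 - W)⁻¹ * (W + Z) * (1 + W * Z)⁻¹ * (1 - W)) (Y + Y₁) (-(X + X₁)))
        - (fun W Z : Matrix m m F => (1 - W)⁻¹ * (W + Z) * (1 + W * Z)⁻¹ * (1 - W)) (Tinv * X * T)
          ((fun W Z : Matrix m m F => (1 - W)⁻¹ * (W + Z) * (1 + W * Z)⁻¹ * (1 - W)) Y (-X))
        - (Tinv * X₁ * T - X₁ + Y₁)) :=
  valBound_twisted_incr_of_sandwich_of_valBound (fun W Z : Matrix m m F => (1 - W)⁻¹ * (W + Z) * (1 + W * Z)⁻¹ * (1 - W)) hρ hγ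
    (fun hW hX => by simpa only [max_self] using valBound_cayleySandwich hW hX hρ hρ)
    (fun hW hX hD hE hδ hε => valBound_cayleySandwich_incr_both hW hX hD hE hρ hδ hε) hW hD hX hY hX₁ hY₁

/-! ## §3 Additive third slot `E` (★ (TJ2) part 1) at a non-integral base point -/

/-- **THE TUBE IN THE CHART, THIRD SLOT FREE, NON-INTEGRAL BASE POINT**: `T⁻¹·c(X)·T·c(Y)·c(X′) = c(Θ)`, `Θ = S(T⁻¹XT, S(Y, X′))`, for `X, Y, X′ ≤ ρ < 1` and the
conjugate `T⁻¹XT ≤ ρ` (★ `cayley_twisted_triple_slot` has `T, T⁻¹` integral instead). [cite: Serre1992LALG, Part II Ch. IV §8] [cite: PlatonovRapinchuk1994, §3.3] -/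
theorem cayley_twisted_triple_slot_of_valBound {ρ : ValueGroupWithZero F} {T Tinv X Y X' : Matrix m m F} (hT : T * Tinv = 1) (hT' : Tinv * T = 1)
    (hX : ValBound ρ X) (hXc : ValBound ρ (Tinv * X * T)) (hY : ValBound ρ Y) (hX' : ValBound ρ X') (hρ : ρ < 1) :
    Tinv * cayley X * T * cayley Y * cayley X'
      = cayley ((1 - Tinv * X * T)⁻¹ * (Tinv * X * T + ((1 - Y)⁻¹ * (Y + X') * (1 + Y * X')⁻¹ * (1 - Y)))
          * (1 + (Tinv * X * T) * ((1 - Y)⁻¹ * (Y + X') * (1 + Y * X')⁻¹ * (1 - Y)))⁻¹ * (1 - Tinv * X * T)) := by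
  obtain ⟨hXu, -, -⟩ := isUnit_det_one_sub_of_valBound hX hρ
  obtain ⟨hXcu, -, -⟩ := isUnit_det_one_sub_of_valBound hXc hρ
  obtain ⟨hYu, -, -⟩ := isUnit_det_one_sub_of_valBound hY hρ
  obtain ⟨hX'u, -, -⟩ := isUnit_det_one_sub_of_valBound hX' hρ
  obtain ⟨hBu, -, -⟩ := isUnit_det_one_add_mul_of_valBound hY hX' hρ hρ.le
  have hZ : ValBound ρ ((1 - Y)⁻¹ * (Y + X') * (1 + Y * X')⁻¹ * (1 - Y)) := by
    simpa using valBound_cayleySandwich hY hX' hρ hρ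
  obtain ⟨hZu, -, -⟩ := isUnit_det_one_sub_of_valBound hZ hρ
  obtain ⟨hB'u, -, -⟩ := isUnit_det_one_add_mul_of_valBound hXc hZ hρ hρ.le
  rw [conj_cayley hT hT' hXu, Matrix.mul_assoc, cayley_mul_cayley_eq_cayley hYu hX'u hBu, cayley_mul_cayley_eq_cayley hXcu hZu hB'u]

/-- The tube map with third slot `X′` stays in the box at a non-integral base point: `Θ ≤ ρ` from `T⁻¹XT, Y, X′ ≤ ρ < 1`. [cite: Serre1992LALG, Part II Ch. IV §8] -/
theorem valBound_twistedSandwich_slot_of_valBound {ρ : ValueGroupWithZero F} {T Tinv X Y X' : Matrix m m F}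
    (hXc : ValBound ρ (Tinv * X * T)) (hY : ValBound ρ Y) (hX' : ValBound ρ X') (hρ : ρ < 1) :
    ValBound ρ ((1 - Tinv * X * T)⁻¹ * (Tinv * X * T + ((1 - Y)⁻¹ * (Y + X') * (1 + Y * X')⁻¹ * (1 - Y)))
          * (1 + (Tinv * X * T) * ((1 - Y)⁻¹ * (Y + X') * (1 + Y * X')⁻¹ * (1 - Y)))⁻¹ * (1 - Tinv * X * T)) := by
  have hZ : ValBound ρ ((1 - Y)⁻¹ * (Y + X') * (1 + Y * X')⁻¹ * (1 - Y)) := by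
    simpa using valBound_cayleySandwich hY hX' hρ hρ
  simpa using valBound_cayleySandwich hXc hZ hρ hρ

omit [DecidableEq m] in
/-- **THE FILTERED NEWTON ESTIMATE FOR A TWISTED COMPOSITE WITH AN ADDITIVE THIRD SLOT AT A NON-INTEGRAL BASE POINT**: for ANY box-stable binary operation `S` with joint
increments gaining the factor `ρ` and any additive `E`, the tube map `Θ(X, Y) := S(T⁻¹XT, S(Y, E X))` satisfies
`Θ(X + X₁, Y + Y₁) − Θ(X, Y) − (T⁻¹X₁T + E X₁ + Y₁) ≤ ργ` as soon as `T⁻¹XT, Y, E X ≤ ρ < 1` and `T⁻¹X₁T, Y₁, E X₁ ≤ γ ≤ ρ` (★ `valBound_twisted_incr_of_sandwich_slot` takes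
`T, T⁻¹` integral and `X, X₁` instead of the two conjugates). [cite: Serre1992LALG, Part II Ch. IV §8] [cite: Rogawski1990, §12.5 p. 186] -/
theorem valBound_twisted_incr_of_sandwich_slot_of_valBound (S : Matrix m m F → Matrix m m F → Matrix m m F) {ρ γ : ValueGroupWithZero F} (hρ : ρ < 1) (hγ : γ ≤ ρ)
    (hbox : ∀ {W X : Matrix m m F}, ValBound ρ W → ValBound ρ X → ValBound ρ (S W X))
    (hincr : ∀ {δ ε : ValueGroupWithZero F} {W X D D' : Matrix m m F}, ValBound ρ W → ValBound ρ X → ValBound δ D → ValBound ε D' →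
      δ ≤ ρ → ε ≤ ρ → ValBound (ρ * max δ ε) (S (W + D) (X + D') - S W X - D - D'))
    (E : Matrix m m F →+ Matrix m m F) {T Tinv X Y X₁ Y₁ : Matrix m m F} (hW : ValBound ρ (Tinv * X * T)) (hD : ValBound γ (Tinv * X₁ * T))
    (hY : ValBound ρ Y) (hY₁ : ValBound γ Y₁) (hEX : ValBound ρ (E X)) (hEX₁ : ValBound γ (E X₁)) :
    ValBound (ρ * γ) (S (Tinv * (X + X₁) * T) (S (Y + Y₁) (E (X + X₁))) - S (Tinv * X * T) (S Y (E X)) - (Tinv * X₁ * T + E X₁ + Y₁)) := by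
  -- inner increment: `S (Y + Y₁) (E X + E X₁) − S Y (E X)` is `Y₁ + E X₁` up to `ργ`, hence `≤ γ`
  have hinner : ValBound (ρ * γ) (S (Y + Y₁) (E X + E X₁) - S Y (E X) - Y₁ - E X₁) := by
    simpa only [max_self] using hincr hY hEX hY₁ hEX₁ hγ hγ
  have hZ : ValBound ρ (S Y (E X)) := hbox hY hEX
  have hE' : ValBound γ (S (Y + Y₁) (E X + E X₁) - S Y (E X)) := by
    have e : S (Y + Y₁) (E X + E X₁) - S Y (E X) = (S (Y + Y₁) (E X + E X₁) - S Y (E X) - Y₁ - E X₁) + (Y₁ + E X₁) := by abel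
    rw [e]
    refine (hinner.mono ?_).add (hY₁.add hEX₁)
    calc ρ * γ ≤ 1 * γ := mul_le_mul' hρ.le le_rfl
      _ = γ := one_mul γ
  -- outer increment
  have houter : ValBound (ρ * γ) (S (Tinv * X * T + Tinv * X₁ * T) (S Y (E X) + (S (Y + Y₁) (E X + E X₁) - S Y (E X)))
      - S (Tinv * X * T) (S Y (E X)) - Tinv * X₁ * T - (S (Y + Y₁) (E X + E X₁) - S Y (E X))) := by
    simpa only [max_self] using hincr hW hZ hD hE' hγ hγ
  -- assemble
  have eW : Tinv * (X + X₁) * T = Tinv * X * T + Tinv * X₁ * T := by rw [Matrix.mul_add, Matrix.add_mul]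
  have eZ : S Y (E X) + (S (Y + Y₁) (E X + E X₁) - S Y (E X)) = S (Y + Y₁) (E X + E X₁) := by abel
  rw [eW, map_add E X X₁, ← eZ]
  have e : S (Tinv * X * T + Tinv * X₁ * T) (S Y (E X) + (S (Y + Y₁) (E X + E X₁) - S Y (E X))) - S (Tinv * X * T) (S Y (E X))
        - (Tinv * X₁ * T + E X₁ + Y₁)
      = (S (Tinv * X * T + Tinv * X₁ * T) (S Y (E X) + (S (Y + Y₁) (E X + E X₁) - S Y (E X)))
          - S (Tinv * X * T) (S Y (E X)) - Tinv * X₁ * T - (S (Y + Y₁) (E X + E X₁) - S Y (E X)))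
        + (S (Y + Y₁) (E X + E X₁) - S Y (E X) - Y₁ - E X₁) := by abel
  rw [e]
  exact houter.add hinner

/-- **THE FILTERED NEWTON ESTIMATE FOR THE TUBE MAP WITH AN ADDITIVE THIRD SLOT AT A NON-INTEGRAL BASE POINT** (Cayley-sandwich instance): with
`Θ(X, Y) = S(T⁻¹XT, S(Y, E X))`, `S(W, Z) = (1 − W)⁻¹(W + Z)(1 + WZ)⁻¹(1 − W)`, `L(X₁, Y₁) = T⁻¹X₁T + E X₁ + Y₁`:
`Θ(X + X₁, Y + Y₁) − Θ(X, Y) − L(X₁, Y₁) ≤ ργ` for `T⁻¹XT, Y, E X ≤ ρ < 1`, `T⁻¹X₁T, Y₁, E X₁ ≤ γ ≤ ρ`. [cite: Serre1992LALG, Part II Ch. IV §8] [cite: Rogawski1990, §12.5 p. 186] -/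
theorem valBound_twistedSandwich_incr_slot_of_valBound {ρ γ : ValueGroupWithZero F} (hρ : ρ < 1) (hγ : γ ≤ ρ) (E : Matrix m m F →+ Matrix m m F)
    {T Tinv X Y X₁ Y₁ : Matrix m m F} (hW : ValBound ρ (Tinv * X * T)) (hD : ValBound γ (Tinv * X₁ * T)) (hY : ValBound ρ Y)
    (hY₁ : ValBound γ Y₁) (hEX : ValBound ρ (E X)) (hEX₁ : ValBound γ (E X₁)) :
    ValBound (ρ * γ)
      ((fun W Z : Matrix m m F => (1 - W)⁻¹ * (W + Z) * (1 + W * Z)⁻¹ * (1 - W)) (Tinv * (X + X₁) * T)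
          ((fun W Z : Matrix m m F => (1 - W)⁻¹ * (W + Z) * (1 + W * Z)⁻¹ * (1 - W)) (Y + Y₁) (E (X + X₁)))
        - (fun W Z : Matrix m m F => (1 - W)⁻¹ * (W + Z) * (1 + W * Z)⁻¹ * (1 - W)) (Tinv * X * T)
          ((fun W Z : Matrix m m F => (1 - W)⁻¹ * (W + Z) * (1 + W * Z)⁻¹ * (1 - W)) Y (E X))
        - (Tinv * X₁ * T + E X₁ + Y₁)) :=
  valBound_twisted_incr_of_sandwich_slot_of_valBound (fun W Z : Matrix m m F => (1 - W)⁻¹ * (W + Z) * (1 + W * Z)⁻¹ * (1 - W)) hρ hγ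
    (fun hW hX => by simpa only [max_self] using valBound_cayleySandwich hW hX hρ hρ)
    (fun hW hX hD hE hδ hε => valBound_cayleySandwich_incr_both hW hX hD hE hρ hδ hε) E hW hD hY hY₁ hEX hEX₁

/-! ## §4 Sanity: the ★ integral statements are the case `γ = γ′ = 1` (examples, not exports) -/

/-- ★ C5's integral conjugation bound is the case `γ = γ′ = 1` of §1. -/
example {ρ : ValueGroupWithZero F} {T Tinv X : Matrix m m F} (hT1 : ValBound 1 T) (hTinv1 : ValBound 1 Tinv) (hX : ValBound ρ X) :
    ValBound ρ (Tinv * X * T) := by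
  simpa using valBound_conj_of_valBound hT1 hTinv1 hX

/-- ★ (TJ2) part 1's integral Newton estimate follows from §3 with the conjugate bounds supplied by ★ `valBound_conj`. -/
example {ρ γ : ValueGroupWithZero F} (hρ : ρ < 1) (hγ : γ ≤ ρ) (E : Matrix m m F →+ Matrix m m F)
    {T Tinv X Y X₁ Y₁ : Matrix m m F} (hT1 : ValBound 1 T) (hTinv1 : ValBound 1 Tinv) (hX : ValBound ρ X) (hY : ValBound ρ Y)
    (hX₁ : ValBound γ X₁) (hY₁ : ValBound γ Y₁) (hEX : ValBound ρ (E X)) (hEX₁ : ValBound γ (E X₁)) :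
    ValBound (ρ * γ)
      ((fun W Z : Matrix m m F => (1 - W)⁻¹ * (W + Z) * (1 + W * Z)⁻¹ * (1 - W)) (Tinv * (X + X₁) * T)
          ((fun W Z : Matrix m m F => (1 - W)⁻¹ * (W + Z) * (1 + W * Z)⁻¹ * (1 - W)) (Y + Y₁) (E (X + X₁)))
        - (fun W Z : Matrix m m F => (1 - W)⁻¹ * (W + Z) * (1 + W * Z)⁻¹ * (1 - W)) (Tinv * X * T)
          ((fun W Z : Matrix m m F => (1 - W)⁻¹ * (W + Z) * (1 + W * Z)⁻¹ * (1 - W)) Y (E X))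
        - (Tinv * X₁ * T + E X₁ + Y₁)) :=
  valBound_twistedSandwich_incr_slot_of_valBound hρ hγ E (valBound_conj hT1 hTinv1 hX) (valBound_conj hT1 hTinv1 hX₁) hY hY₁ hEX hEX₁

end Summit.HodgeConjecture.HodgeConjecture.R90.S4
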